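import Summits.NavierStokesRegularity.NavierStokesRegularity.Theses.RellichScar
import Summits.NavierStokesRegularity.NavierStokesRegularity.Theorems.ScarRigidity.Negative.LogicAndLoadBearing
import Literature.Analysis.FluidPDE.TypeIAncientMild
import Literature.Analysis.FluidPDE.ParasiticSlabFlow
import Literature.Analysis.FluidPDE.SpaceTimeCalculus
import Literature.Analysis.FluidPDE.WholeSpaceIBPIntegrable
import HarnessLib

/-!
# `ScarRigidity` — line `finite-energy-log-convexity`, stub `stub_logConvexityBelowThreshold`:
# the difference equation of two classical solutions and the pressure annihilation
# (crux stmt-NavierStokesRegularity-11717)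

Helper file 6 of S4 (`stub_logConvexityBelowThreshold`). Two small inputs of the energy package
`stub_coulombEnergyPackage`:

* `deriv_sub_eq_of_classical` — **the difference equation.** For two classical solutions
  `(V₁, Q₁)`, `(V₂, Q₂)` of Navier–Stokes (`ν = 1`, `f = 0`) on the open slab `t < 0`, the difference
  `w = V₁ - V₂` satisfies, pointwise,
  `∂ₜw = (ΔV₁ - ΔV₂) - (∇Q₁ - ∇Q₂) - ((w·∇)V₁ + (V₂·∇)w)`
  (the momentum equations with the two-sided time derivative, `timeDerivWithin_eq_deriv` on the open
  time set, and the algebra `(V₁·∇)V₁ - (V₂·∇)V₂ = (w·∇)V₁ + (V₂·∇)w`, `convect_self_sub_convect_self`);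
* `integral_inner_gradient_eq_zero_of_isDivFree` — **the pressure drops out**, `L¹` form:
  `∫ ⟪∇p, w⟫ = 0` for `p ∈ C¹`, `w ∈ C¹` divergence free with `p w`, `⟪w, ∇p⟫ ∈ L¹` (no compact
  support; the tree's `integral_mul_divergence_add_eq_zero_of_integrable`). In S4 it is applied with
  `p = (Q₁ - a₁(t)) - (Q₂ - a₂(t))` (same gradient as `Q₁ - Q₂`, and `|p| ≲ ρ⁻²` makes `p w ∈ L¹`)
  against `w` and against `ψ = (-Δ)⁻¹w`.
-/

noncomputable section

open Set Filter Function MeasureTheory Metric TopologicalSpace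
open scoped Topology ENNReal NNReal InnerProductSpace RealInnerProductSpace Laplacian
open Literature.Analysis.FluidPDE
open Summit.NavierStokesRegularity.NavierStokesRegularity.Theses.RellichScar
open Summit.NavierStokesRegularity.NavierStokesRegularity.Theorems.ScarRigidity.Negative

set_option linter.dupNamespace false

namespace Summit.NavierStokesRegularity.NavierStokesRegularity.Theorems.RellichScarScarRigidity

variable {E : Type*} [NormedAddCommGroup E] [InnerProductSpace ℝ E] [FiniteDimensional ℝ E]

/-! ## The convection difference -/

omit [FiniteDimensional ℝ E] in
/-- `(u·∇)u - (v·∇)v = ((u-v)·∇)u + (v·∇)(u-v)` at points where `u, v` are differentiable. [folklore] -/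
theorem convect_self_sub_convect_self {u v : E → E} {x : E} (hu : DifferentiableAt ℝ u x)
    (hv : DifferentiableAt ℝ v x) :
    convect u u x - convect v v x =
      convect (fun y => u y - v y) u x + convect v (fun y => u y - v y) x := by
  simp only [convect, fderiv_fun_sub hu hv, _root_.sub_apply, map_sub]
  abel

/-! ## The difference equation -/

variable [MeasurableSpace E] [BorelSpace E]

omit [MeasurableSpace E] [BorelSpace E] in
/-- **The difference equation of two classical solutions.** For classical solutions `(V₁, Q₁)`,
`(V₂, Q₂)` of Navier–Stokes with `ν = 1`, `f = 0` on the open slab `t < 0` and `w = V₁ - V₂`: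
`∂ₜV₁ - ∂ₜV₂ = (ΔV₁ - ΔV₂) - (∇Q₁ - ∇Q₂) - ((w·∇)V₁ + (V₂·∇)w)` at every `t < 0`, `x`. [folklore] -/
theorem deriv_sub_eq_of_classical {V₁ V₂ : ℝ → E → E} {Q₁ Q₂ : ℝ → E → ℝ}
    (h₁ : IsClassicalNSSolutionOn (Iio (0 : ℝ)) 1 0 V₁ Q₁)
    (h₂ : IsClassicalNSSolutionOn (Iio (0 : ℝ)) 1 0 V₂ Q₂) {t : ℝ} (ht : t < 0) (x : E) :
    deriv (fun s => V₁ s x) t - deriv (fun s => V₂ s x) t =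
      ((Δ (V₁ t)) x - (Δ (V₂ t)) x) - (gradient (Q₁ t) x - gradient (Q₂ t) x) -
        (convect (fun y => V₁ t y - V₂ t y) (V₁ t) x +
          convect (V₂ t) (fun y => V₁ t y - V₂ t y) x) := by
  have m₁ := h₁.momentum t ht x
  have m₂ := h₂.momentum t ht x
  rw [timeDerivWithin_eq_deriv isOpen_Iio ht] at m₁ m₂
  simp only [Pi.zero_apply, add_zero, one_smul] at m₁ m₂
  have hd₁ : DifferentiableAt ℝ (V₁ t) x :=
    ((h₁.contDiff_velocity ht).differentiable (by simp)) x
  have hd₂ : DifferentiableAt ℝ (V₂ t) x :=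
    ((h₂.contDiff_velocity ht).differentiable (by simp)) x
  have hc := convect_self_sub_convect_self hd₁ hd₂
  have e₁ : deriv (fun s => V₁ s x) t = (Δ (V₁ t)) x - gradient (Q₁ t) x - convect (V₁ t) (V₁ t) x :=
    by rw [← m₁]; abel
  have e₂ : deriv (fun s => V₂ s x) t = (Δ (V₂ t)) x - gradient (Q₂ t) x - convect (V₂ t) (V₂ t) x :=
    by rw [← m₂]; abel
  rw [e₁, e₂, ← hc]
  abel

/-! ## The pressure drops out against divergence-free fields (`L¹` form) -/

/-- **`∫ ⟪∇p, w⟫ = 0`** for `p ∈ C¹(E; ℝ)` and a divergence-free `w ∈ C¹(E; E)` with `p w ∈ L¹` and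
`⟪w, ∇p⟫ ∈ L¹` (`∫ p div w + ∫ ⟪w, ∇p⟫ = 0`, `integral_mul_divergence_add_eq_zero_of_integrable`,
and `div w = 0`; Leray 1934, (17): the pressure disappears from the weak relation). [cite: Leray1934, §6 (1.11) p. 203] -/
theorem integral_inner_gradient_eq_zero_of_isDivFree {p : E → ℝ} {w : E → E} (hp : ContDiff ℝ 1 p)
    (hw : ContDiff ℝ 1 w) (hdiv : VectorCalculus.IsDivFree w)
    (h0 : Integrable fun x => p x • w x) (h1 : Integrable fun x => ⟪w x, gradient p x⟫) :
    ∫ x, ⟪gradient p x, w x⟫ = 0 := by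
  have hz : (fun x => p x * VectorCalculus.divergence w x) = fun _ => 0 := by
    funext x; rw [hdiv x, mul_zero]
  have h := integral_mul_divergence_add_eq_zero_of_integrable hp hw h0
    (by rw [hz]; exact integrable_zero _ _ _) h1
  rw [hz, integral_zero, zero_add] at h
  rw [← h]
  exact integral_congr_ae (Eventually.of_forall fun x => real_inner_comm _ _)

/-! ## Registered sub-goal (helper stub of `stub_logConvexityBelowThreshold`) -/

/-- **Registered helper stub `stub_differenceEquation`** (crux stmt-NavierStokesRegularity-11717, line
`finite-energy-log-convexity`, helper of S4): the difference equation of two classical solutions on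
the open slab of `ℝ³`, as registered. [folklore] -/
theorem stub_differenceEquation :
    ∀ (V₁ V₂ : ℝ → EuclideanSpace ℝ (Fin 3) → EuclideanSpace ℝ (Fin 3))
      (Q₁ Q₂ : ℝ → EuclideanSpace ℝ (Fin 3) → ℝ) (t : ℝ) (x : EuclideanSpace ℝ (Fin 3)),
      IsClassicalNSSolutionOn (Iio (0 : ℝ)) 1 0 V₁ Q₁ → IsClassicalNSSolutionOn (Iio (0 : ℝ)) 1 0 V₂ Q₂ →
      t < 0 →
      deriv (fun s => V₁ s x) t - deriv (fun s => V₂ s x) t =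
        (Laplacian.laplacian (V₁ t) x - Laplacian.laplacian (V₂ t) x) -
          (gradient (Q₁ t) x - gradient (Q₂ t) x) -
          (convect (fun y => V₁ t y - V₂ t y) (V₁ t) x +
            convect (V₂ t) (fun y => V₁ t y - V₂ t y) x) :=
  fun _V₁ _V₂ _Q₁ _Q₂ _t x h₁ h₂ ht => deriv_sub_eq_of_classical h₁ h₂ ht x

end Summit.NavierStokesRegularity.NavierStokesRegularity.Theorems.RellichScarScarRigidity

end
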